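import Literature.AlgebraicGeometry.AbelianSchemes.AbelianSchemeKOfLUnramified
import Literature.Algebra.Module.FibreRankSemicontinuity
import HarnessLib

/-!
# `K(L) → S` is finite ÉTALE over an integral base of characteristic zero AS SOON AS its fibre degree is constant
# (Mumford, *Abelian Varieties* §13 + §5 Cor. 2; Hartshorne II Ex. 5.8 (c); Görtz–Wedhorn II, Prop. 27.86 / 27.187)

Layer `Literature/AlgebraicGeometry/AbelianSchemes`, namespace `Literature.AlgebraicGeometry.AbelianSchemes.AbelianSchemeOver`.
Cell `hodgecm-mathlib` (D-0151), F-DAG leaf F-2c «étaleness of `K(L) → S`» — the CONDITIONAL CLOSER over an INTEGRAL base (file U4 of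
B-p08 (g12); sequencer B-plan1 (g16)).  THEOREMS ONLY (no definition, no instance, no named fact, no `sorry`).

★ U3 `AbelianSchemeKOfLUnramified` proved: a finite closed subgroup subscheme `Z ↪ A` of an abelian scheme over a Noetherian
`ℚ`-algebra `R` (e.g. `K(L)`) is formally unramified over `Spec R`, and étale as soon as it is FLAT.  Over an INTEGRAL Noetherian base,
flatness of the finite `Z → Spec R` is the local constancy of the fibre rank `p ↦ dim_{κ(p)} (κ(p) ⊗_R Γ(Z, 𝒪))` (★
`Literature.Algebra.Module.projective_of_finrank_residueField_tensor_eq`, [Hartshorne1977] II Ex. 5.8 (c) / [MumfordAV1970] §5 Cor. 2: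
constant fibre rank ⇒ projective ⇒ flat).  Hence:
* `flat_hom_of_finrank_fibre_eq` — `Z → Spec R` finite with constant fibre rank over a Noetherian domain `R` is FLAT;
* **`etale_hom_of_subgroup_of_finrank_fibre_eq`** — and ÉTALE when moreover `R ⊇ ℚ` and `Z` is a closed subgroup subscheme of an
  abelian scheme (★ U3);
* **`exists_kOfL_etale_of_finrank_fibre_eq`** — `K(L)`: for every abelian scheme over a Noetherian domain `R ⊇ ℚ` and every
  rigidified fibrewise-ample rank-one `L`, the representing closed subscheme `Z ↪ A` of `K(L)` is finite, formally unramified, and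
  ÉTALE over `Spec R` PROVIDED its fibre rank is constant.
THE ONE REMAINING INPUT of F-2c over an integral base is thus named precisely: «the fibre rank of `K(L)` — equivalently the number
`|K(L_s̄)|` of geometric points of the (étale, ★ U3 `etale_pullback_obj_hom`) fibres — is locally constant on `S`»
(= `χ(L_s)²`, [MumfordAV1970] §16 Riemann–Roch with §23; not in the tree).  Over a NON-reduced base flatness is «`Λ(L) : A → Â`
finite flat» (F-DAG leaf F-3).  HC_CM is proved only modulo the 7 printed citations until rung 0 closes; this file asserts nothing
about HC.

## References
* [MumfordAV1970] D. Mumford, *Abelian Varieties* (1970), §5 Cor. 2 (p. 50), §13 (p. 123), §16, §23.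
* [Hartshorne1977] R. Hartshorne, *Algebraic Geometry* (1977), II Ex. 5.8 (c).
* [GortzWedhorn2023] U. Görtz, T. Wedhorn, *Algebraic Geometry II* (2023), Prop. 27.86 (p. 633), Prop. 27.187, Cor. 27.63.
-/

set_option autoImplicit false

noncomputable section

-- `TopCat.Presheaf`/`Scheme.Modules` are not reducible (as in ★ `AbelianSchemeKOfL`).
set_option backward.isDefEq.respectTransparency false

open CategoryTheory CategoryTheory.Limits AlgebraicGeometry MonoidalCategory CartesianMonoidalCategory TensorProduct

open scoped MonObj

namespace Literature.AlgebraicGeometry.AbelianSchemes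

open Literature.AlgebraicGeometry.Motives Literature.AlgebraicGeometry.AbelianVarieties
  Literature.AlgebraicGeometry.Modules Literature.AlgebraicGeometry.Morphisms

namespace AbelianSchemeOver

variable {R : Type} [CommRing R]

/-! ## §1 Finite morphisms to an integral Noetherian affine base with constant fibre rank are flat -/

section Flat

variable {Z : Over (Spec (.of R))} [IsFinite Z.hom]

/-- `Γ(Z, 𝒪)` is a finite `R`-algebra through `algebraMapΓ (Z → Spec R)` when `Z → Spec R` is finite. [cite: Hartshorne1977, II Ex. 5.8 (c)] -/
theorem moduleFinite_Γ_of_isFinite :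
    letI := (Literature.AlgebraicGeometry.Motives.algebraMapΓ Z.hom).hom.toAlgebra
    Module.Finite R Γ(Z.left, ⊤) := by
  letI := (Literature.AlgebraicGeometry.Motives.algebraMapΓ Z.hom).hom.toAlgebra
  have h1 : Z.hom.appTop.hom.Finite := Z.hom.finite_appTop
  have h2 : (Scheme.ΓSpecIso (.of R)).inv.hom.Finite :=
    RingHom.Finite.of_surjective _ fun y ↦ ⟨(Scheme.ΓSpecIso (.of R)).hom.hom y, by
      rw [← CommRingCat.comp_apply, Iso.hom_inv_id, CommRingCat.id_apply]⟩
  exact h1.comp h2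

/-- **A finite morphism `Z → Spec R` to an integral Noetherian affine base whose fibre rank `p ↦ dim_{κ(p)} (κ(p) ⊗_R Γ(Z, 𝒪))`
is CONSTANT is FLAT** (★ `projective_of_finrank_residueField_tensor_eq`: constant fibre rank ⇒ `Γ(Z, 𝒪)` projective ⇒ flat;
`Z ≅ Spec Γ(Z, 𝒪)` affine). [cite: Hartshorne1977, II Ex. 5.8 (c)] [cite: MumfordAV1970, §5 Cor. 2 (p. 50)] -/
theorem flat_hom_of_finrank_fibre_eq [IsDomain R] [IsNoetherianRing R] (r : ℕ)
    (h : letI := (Literature.AlgebraicGeometry.Motives.algebraMapΓ Z.hom).hom.toAlgebra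
      ∀ p : PrimeSpectrum R, Module.finrank p.asIdeal.ResidueField (p.asIdeal.ResidueField ⊗[R] Γ(Z.left, ⊤)) = r) :
    Flat Z.hom := by
  letI := (Literature.AlgebraicGeometry.Motives.algebraMapΓ Z.hom).hom.toAlgebra
  haveI : IsAffine Z.left := isAffine_of_isAffineHom Z.hom
  haveI := moduleFinite_Γ_of_isFinite (Z := Z)
  haveI : Module.Projective R Γ(Z.left, ⊤) :=
    Literature.Algebra.Module.projective_of_finrank_residueField_tensor_eq Γ(Z.left, ⊤) r h
  have hflat : Flat (Spec.map (Literature.AlgebraicGeometry.Motives.algebraMapΓ Z.hom)) := by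
    rw [HasRingHomProperty.Spec_iff (P := @Flat)]
    exact RingHom.flat_algebraMap_iff.mpr (inferInstance : Module.Flat R Γ(Z.left, ⊤))
  rw [← Literature.AlgebraicGeometry.Motives.isoSpec_hom_comp_SpecMap_algebraMapΓ Z.hom]
  infer_instance

end Flat

/-! ## §2 Closed subgroup subschemes of abelian schemes: étale from constant fibre rank -/

section Subgroup

variable (A : AbelianSchemeOver (Spec (.of R))) {Z : Over (Spec (.of R))} (i : Z ⟶ A.X) [IsClosedImmersion i.left] [IsFinite Z.hom]
  (he : ∃ e : 𝟙_ (Over (Spec (.of R))) ⟶ Z, e ≫ i = 1)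
  (hm : ∃ m : Z ⊗ Z ⟶ Z, m ≫ i = (CartesianMonoidalCategory.fst Z Z ≫ i) * (CartesianMonoidalCategory.snd Z Z ≫ i))
  (hn : ∃ n : Z ⟶ Z, n ≫ i = i⁻¹)

include i he hm hn in
/-- **A finite closed subgroup subscheme of an abelian scheme over an integral Noetherian `ℚ`-base is ÉTALE over the base as soon as its
fibre rank is constant** (flat by `flat_hom_of_finrank_fibre_eq`, then ★ U3 `etale_hom_of_subgroup_of_flat`).
[cite: GortzWedhorn2023, Prop. 27.86 (p. 633)] [cite: GortzWedhorn2023, Prop. 27.187 and Cor. 27.63] [cite: Hartshorne1977, II Ex. 5.8 (c)] -/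
theorem etale_hom_of_subgroup_of_finrank_fibre_eq [IsDomain R] [IsNoetherianRing R] [Algebra ℚ R] (r : ℕ)
    (h : letI := (Literature.AlgebraicGeometry.Motives.algebraMapΓ Z.hom).hom.toAlgebra
      ∀ p : PrimeSpectrum R, Module.finrank p.asIdeal.ResidueField (p.asIdeal.ResidueField ⊗[R] Γ(Z.left, ⊤)) = r) :
    Etale Z.hom := by
  haveI : Flat Z.hom := flat_hom_of_finrank_fibre_eq r h
  exact A.etale_hom_of_subgroup_of_flat i he hm hn

end Subgroup

/-! ## §3 `K(L)` -/

section KOfL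

variable (A : AbelianSchemeOver (Spec (.of R)))

/-- **`K(L)` IS FINITE ÉTALE OVER AN INTEGRAL BASE OF CHARACTERISTIC ZERO, PROVIDED ITS FIBRE RANK IS CONSTANT**: for every abelian
scheme `A` over a Noetherian domain `R ⊇ ℚ` and every rank-one `L` rigidified along the identity section and fibrewise of the class of an
ample divisor, the closed subscheme `Z ↪ A` representing `K(L)` (★ E13) is finite and formally unramified over `Spec R` (★ U3), and
`Etale Z.hom` follows from the constancy of `p ↦ dim_{κ(p)} (κ(p) ⊗_R Γ(Z, 𝒪))` — equivalently of the number `|K(L_s̄)|` of geometric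
points of the (étale) fibres; that constancy (`= χ(L_s)²`, [MumfordAV1970] §16 / §23) is the one input NOT proved in the tree.
[cite: MumfordAV1970, §13 (p. 123)] [cite: MumfordAV1970, §5 Cor. 2 (p. 50)] [cite: GortzWedhorn2023, Prop. 27.187 and Cor. 27.63] -/
theorem exists_kOfL_etale_of_finrank_fibre_eq [IsDomain R] [IsNoetherianRing R] [Algebra ℚ R] {L : A.left.Modules}
    (hL : HasRank L 1) (hε : CechPic.pullback A.unitSection (detClass (HasRank.isFiniteLocallyFree' hL)) = 1)
    (hΘ : ∀ ⦃Ω : Type⦄ [Field Ω] [IsAlgClosed Ω] (s : Spec (.of Ω) ⟶ Spec (.of R)),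
      ∃ Θ : CartierDivisor (A.fibre s).toAbelianVariety.X.left, Θ.IsAmple ∧
        CechPic.pullback (X := (A.fibre s).toAbelianVariety.X.left) (pullback.fst A.X.hom s)
          (detClass (HasRank.isFiniteLocallyFree' hL)) = Θ.cechClass) :
    ∃ (Z : Over (Spec (.of R))) (i : Z ⟶ A.X) (_ : IsClosedImmersion i.left) (_ : IsFinite Z.hom)
      (_ : FormallyUnramified Z.hom),
      (∀ r : ℕ, (letI := (Literature.AlgebraicGeometry.Motives.algebraMapΓ Z.hom).hom.toAlgebra
          ∀ p : PrimeSpectrum R,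
            Module.finrank p.asIdeal.ResidueField (p.asIdeal.ResidueField ⊗[R] Γ(Z.left, ⊤)) = r) → Etale Z.hom) ∧
        ∀ (T : Over (Spec (.of R))) (u : T ⟶ A.X), (∃ v : T ⟶ Z, v ≫ i = u) ↔ A.MemKOfL L u := by
  obtain ⟨Z, i, hci, hfin, hZ⟩ := A.exists_isClosedImmersion_isFinite_iff_memKOfL_of_isNoetherianRing hL hε hΘ
  obtain ⟨he, hm, hn⟩ := A.exists_one_mul_inv_fac_of_memKOfL i hL hε hZ
  exact ⟨Z, i, hci, hfin, A.formallyUnramified_hom_of_subgroup i he hm hn,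
    fun r hr => A.etale_hom_of_subgroup_of_finrank_fibre_eq i he hm hn r hr, hZ⟩

end KOfL

end AbelianSchemeOver

end Literature.AlgebraicGeometry.AbelianSchemes

end
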